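import Literature.AlgebraicGeometry.Motives.FiniteQuotientQuasiProjective
import Literature.AlgebraicGeometry.Motives.UniversalHypersurfaceQuasiProjective
import Literature.AlgebraicGeometry.HodgeTheory.HodgeGenericQbarDescentProofs
import Literature.AlgebraicGeometry.Motives.RestrictScalarsPoints
import Literature.AlgebraicGeometry.AbelianSchemes.AbelianSchemeConstSubgroupQuotient
import Literature.AlgebraicGeometry.AbelianSchemes.PolarizedAbelianSchemeWithLevelBaseChange
import Literature.AlgebraicGeometry.ModuliOfAbelianVarieties.SiegelFineModuliScheme
import HarnessLib

/-!
# The piece of the universal family over an open `S″ ⊆ 𝓜_ℂ` is quasi-projective over `ℂ`; hence `hcov`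

Topic `AlgebraicGeometry/ModuliOfAbelianVarieties`; namespace `Literature.AlgebraicGeometry.ModuliOfAbelianVarieties`; a
*proofs* file (theorems only). Cell `hodgecm-mathlib`, socket-(B) chain, brick (cov-3A) (B-plan1 (g15) 23:31:31Z ruling):
the `hcov` binder of the (ii)-chain quotient files (`AbelianSchemeOver.quotientBy … (hcov : ∀ x, ∃ O : (A.translationActionOver
u K).StableAffineOpens, x ∈ O.1)`) at the `S″`-family `A′ := (𝓜′.univ.baseChange ι′ℚ).A`.

* §1 (generic, any fields `k → K`): for a `k`-scheme `M`, a morphism `f : E → M` whose total space `E → M → Spec k` is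
  QUASI-PROJECTIVE over `k`, and an OPEN `K`-immersion `ι′ : S″ → M_K` of a `K`-scheme `S″` with `k`-form
  `ι′k : S″ → M` (`ι′ ≫ pr₁ = ι′k`), the base change `E ×_M S″ → S″ → Spec K` is quasi-projective over `K`
  (`isQuasiProjectiveOver_pullback_piece`): it is an OPEN subscheme of `(E → Spec k)_K` (the square
  `E ×_M S″ → E_K; S″ → M_K` is cartesian by pasting, Mathlib `IsPullback.of_bot` / `of_right`), and quasi-projectivity
  passes along `k → K` (★ `IsQuasiProjectiveOver.baseChangeHom`) and to open subschemes (★ `of_isOpenImmersion`).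
* §2 `hcov_baseChange_piece` — for an abelian scheme `A → M`: every point of `A ×_M S″` lies in a `K₀`-stable affine open
  over `Spec K`, for every finite group `K₀` of sections (★ `ActionOver.forall_exists_stableAffineOpen_of_isQuasiProjectiveOver`,
  SGA 1 V 1.8); §3 `isQuasiProjectiveOver_univ_piece`, **`hcov_univ_piece`** — the instance `M = 𝓜.M`, `A = 𝓜.univ.A` for a
  fine Siegel moduli scheme, with the quasi-projectivity of the universal total space `Over.mk (𝓜.univ.A.X.hom ≫ 𝓜.M.hom)`
  as a HYPOTHESIS (it is (F-c″), supplied Summits-side by `W1.smooth_qproj_of_F`).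

Everything is proved; no named facts; no definitions. Mathlib searched and used (pin): `IsPullback.of_hasPullback`,
`IsPullback.of_bot`, `IsPullback.of_right`, `MorphismProperty.of_isPullback` (`IsOpenImmersion` is stable under base
change), `pullback.hom_ext`, `Over.homMk`, `Over.w`.

## References

* A. Grothendieck, *SGA 1*, Exp. V, Prop. 1.8. [SGA1]
* D. Mumford, *Abelian Varieties* (2nd ed. 1974), §7, Theorem p. 66 and Remark p. 69. [MumfordAV1970]
* D. Mumford, J. Fogarty, F. Kirwan, *Geometric Invariant Theory*, 3rd ed. (1994), Ch. 7 §2 Definition 7.2 (p. 129),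
  §3 Theorem 7.9 (p. 139). [MumfordFogartyKirwan1994]
-/

noncomputable section

open CategoryTheory CategoryTheory.Limits AlgebraicGeometry MonoidalCategory CartesianMonoidalCategory
open scoped MonObj
open Literature.AlgebraicGeometry.Motives (SchemeOver baseChange baseChangeHomFst)
open Literature.AlgebraicGeometry.HodgeTheory (IsQuasiProjectiveOver)
open Literature.AlgebraicGeometry.AbelianSchemes Literature.AlgebraicGeometry.RelativeSpec

universe u

namespace Literature.AlgebraicGeometry.ModuliOfAbelianVarieties

/-! ### §1 An open piece of a base change of a quasi-projective total space is quasi-projective -/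

section Piece

variable {k K : Type u} [Field k] [Field K] [Algebra k K] {M : SchemeOver k} {E : Scheme.{u}} (f : E ⟶ M.left)
  {S'' : SchemeOver K} (ι'k : S''.restrictScalars k ⟶ M)

/-- The square `E ×_M S″ → E → M → Spec k` / `E ×_M S″ → S″ → Spec K → Spec k` commutes (so the comparison map to
`E ×_{Spec k} Spec K` exists). [folklore] -/
private theorem pullback_piece_comm :
    pullback.fst f ι'k.left ≫ f ≫ M.hom =
      (pullback.snd f ι'k.left ≫ S''.hom) ≫ Spec.map (CommRingCat.ofHom (algebraMap k K)) := by
  rw [← Category.assoc, pullback.condition, Category.assoc, Category.assoc]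
  exact congrArg (pullback.snd f ι'k.left ≫ ·) ((Over.w ι'k).trans (Motives.SchemeOver.restrictScalars_hom k S''))

/-- **The `S″`-piece `E ×_M S″` of `f : E → M` is an OPEN subscheme of the base change `(E/k)_K`**: for an open
`K`-immersion `ι′ : S″ → M_K` with `k`-form `ι′k` (`ι′ ≫ pr₁ = ι′k`), the comparison map `E ×_M S″ → E ×_{Spec k} Spec K`
(lifting `pr₁` and `E ×_M S″ → S″ → Spec K`) sits in a cartesian square over `ι′` (pasting: `E_K → M_K` is the base change
of `f`, Mathlib `IsPullback.of_bot`; then cancel the right square, `IsPullback.of_right`), hence is an open immersion.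
[cite: MumfordFogartyKirwan1994, Ch. 7 §2 Definition 7.2 (p. 129), setting] -/
theorem isOpenImmersion_lift_pullback_piece (ι' : S'' ⟶ (baseChange k K).obj M) [IsOpenImmersion ι'.left]
    (hι : ι'.left ≫ baseChangeHomFst (algebraMap k K) M = ι'k.left)
    (w : pullback.fst f ι'k.left ≫ f ≫ M.hom =
      (pullback.snd f ι'k.left ≫ S''.hom) ≫ Spec.map (CommRingCat.ofHom (algebraMap k K))) :
    IsOpenImmersion (pullback.lift (f := f ≫ M.hom) (g := Spec.map (CommRingCat.ofHom (algebraMap k K)))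
      (pullback.fst f ι'k.left) (pullback.snd f ι'k.left ≫ S''.hom) w) := by
  set σ := Spec.map (CommRingCat.ofHom (algebraMap k K)) with hσ
  -- the base change `τ : E_K → M_K` of `f` and its cartesian square over `pr₁ : M_K → M`
  let τ : pullback (f ≫ M.hom) σ ⟶ pullback M.hom σ :=
    pullback.lift (pullback.fst (f ≫ M.hom) σ ≫ f) (pullback.snd (f ≫ M.hom) σ)
      (by rw [Category.assoc, pullback.condition])
  have hτ₁ : τ ≫ pullback.fst M.hom σ = pullback.fst (f ≫ M.hom) σ ≫ f := pullback.lift_fst _ _ _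
  have hτ₂ : τ ≫ pullback.snd M.hom σ = pullback.snd (f ≫ M.hom) σ := pullback.lift_snd _ _ _
  have sq4 : IsPullback (pullback.fst (f ≫ M.hom) σ) τ f (pullback.fst M.hom σ) := by
    refine IsPullback.of_bot ?_ hτ₁.symm (IsPullback.of_hasPullback M.hom σ)
    rw [hτ₂]
    exact IsPullback.of_hasPullback (f ≫ M.hom) σ
  -- the comparison map `φ` and the left square over `ι′`
  set φ := pullback.lift (f := f ≫ M.hom) (g := σ) (pullback.fst f ι'k.left) (pullback.snd f ι'k.left ≫ S''.hom) w
    with hφ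
  have hφ₁ : φ ≫ pullback.fst (f ≫ M.hom) σ = pullback.fst f ι'k.left := pullback.lift_fst _ _ _
  have hφ₂ : φ ≫ pullback.snd (f ≫ M.hom) σ = pullback.snd f ι'k.left ≫ S''.hom := pullback.lift_snd _ _ _
  have hι' : ι'.left ≫ pullback.fst M.hom σ = ι'k.left := hι
  have hcomm : φ ≫ τ = pullback.snd f ι'k.left ≫ ι'.left := by
    apply pullback.hom_ext
    · simp only [Category.assoc, hτ₁]
      rw [← Category.assoc, hφ₁, pullback.condition]
      exact (congrArg (pullback.snd f ι'k.left ≫ ·) hι').symm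
    · simp only [Category.assoc, hτ₂, hφ₂]
      exact (congrArg (pullback.snd f ι'k.left ≫ ·) (Over.w ι')).symm
  have sq3 : IsPullback (φ ≫ pullback.fst (f ≫ M.hom) σ) (pullback.snd f ι'k.left) f
      (ι'.left ≫ pullback.fst M.hom σ) := by
    convert IsPullback.of_hasPullback f ι'k.left using 1
    first | exact hφ₁ | exact hι'
  have sq : IsPullback φ (pullback.snd f ι'k.left) τ ι'.left := IsPullback.of_right sq3 hcomm sq4
  exact MorphismProperty.of_isPullback (P := @IsOpenImmersion) sq.flip (inferInstanceAs (IsOpenImmersion ι'.left))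

/-- **The `S″`-piece of a quasi-projective total space is quasi-projective**: if `E → M → Spec k` is quasi-projective over
`k`, then for an open `K`-immersion `ι′ : S″ → M_K` with `k`-form `ι′k`, the `K`-scheme `E ×_M S″ → S″ → Spec K` is
quasi-projective over `K` (open in `(E/k)_K`, ★ `IsQuasiProjectiveOver.baseChangeHom` + ★ `of_isOpenImmersion`).
[cite: MumfordFogartyKirwan1994, Ch. 7 §3 Theorem 7.9 (p. 139), setting] -/
theorem isQuasiProjectiveOver_pullback_piece (ι' : S'' ⟶ (baseChange k K).obj M) [IsOpenImmersion ι'.left]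
    (hι : ι'.left ≫ baseChangeHomFst (algebraMap k K) M = ι'k.left)
    (hT : IsQuasiProjectiveOver (Over.mk (f ≫ M.hom) : SchemeOver k)) :
    IsQuasiProjectiveOver (Over.mk (pullback.snd f ι'k.left ≫ S''.hom) : SchemeOver K) := by
  have hTK : IsQuasiProjectiveOver ((baseChange k K).obj (Over.mk (f ≫ M.hom) : SchemeOver k)) := by
    rw [← Motives.baseChangeHom_algebraMap]
    exact hT.baseChangeHom (algebraMap k K)
  let i : (Over.mk (pullback.snd f ι'k.left ≫ S''.hom) : SchemeOver K) ⟶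
      (baseChange k K).obj (Over.mk (f ≫ M.hom) : SchemeOver k) :=
    Over.homMk (pullback.lift (f := f ≫ M.hom) (g := Spec.map (CommRingCat.ofHom (algebraMap k K)))
      (pullback.fst f ι'k.left) (pullback.snd f ι'k.left ≫ S''.hom) (pullback_piece_comm f ι'k)) (pullback.lift_snd _ _ _)
  haveI : IsOpenImmersion i.left := isOpenImmersion_lift_pullback_piece f ι'k ι' hι (pullback_piece_comm f ι'k)
  exact IsQuasiProjectiveOver.of_isOpenImmersion i hTK

end Piece

/-! ### §2 `hcov` for the piece of an abelian scheme -/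

section Hcov

variable {k K : Type u} [Field k] [Field K] [Algebra k K] {M : SchemeOver k} (A : AbelianSchemeOver M.left)
  {S'' : SchemeOver K} (ι' : S'' ⟶ (baseChange k K).obj M) [IsOpenImmersion ι'.left]
  (ι'k : S''.restrictScalars k ⟶ M)

/-- **`hcov` for `A ×_M S″ → S″ → Spec K`**: if the total space `A → M → Spec k` is quasi-projective over `k`, every point of
`A ×_M S″` lies in a `K₀`-stable affine open over `Spec K` for every finite group `K₀` of sections acting by translations —
the `hcov` binder of ★ `AbelianSchemeOver.quotientBy` at `u := S″.hom` (★ SGA 1 V 1.8 on the quasi-projective `K`-scheme of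
§1). [cite: SGA1, Exp. V, Prop. 1.8] [cite: MumfordAV1970, §7 Remark p. 69] -/
theorem hcov_baseChange_piece (hι : ι'.left ≫ baseChangeHomFst (algebraMap k K) M = ι'k.left)
    (hT : IsQuasiProjectiveOver (Over.mk (A.X.hom ≫ M.hom) : SchemeOver k))
    (K₀ : Subgroup (A.baseChange (S' := S''.left) ι'k.left).Sections) [Finite K₀] :
    ∀ x : (A.baseChange (S' := S''.left) ι'k.left).left,
      ∃ O : ((A.baseChange (S' := S''.left) ι'k.left).translationActionOver S''.hom K₀).StableAffineOpens, x ∈ O.1 :=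
  fun x => ActionOver.forall_exists_stableAffineOpen_of_isQuasiProjectiveOver
    (X := (Over.mk ((A.baseChange (S' := S''.left) ι'k.left).X.hom ≫ S''.hom) : SchemeOver K))
    ((A.baseChange (S' := S''.left) ι'k.left).translationActionOver S''.hom K₀) (isQuasiProjectiveOver_pullback_piece A.X.hom ι'k ι' hι hT) x

end Hcov

/-! ### §3 The universal family over a fine Siegel moduli scheme -/

section Univ

variable {g N : ℕ} {δ : Fin g → ℕ} (𝓜 : SiegelFineModuliScheme g N δ)
  {S'' : SchemeOver ℂ} (ι' : S'' ⟶ (baseChange ℚ ℂ).obj 𝓜.M) [IsOpenImmersion ι'.left]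
  (ι'ℚ : S''.restrictScalars ℚ ⟶ 𝓜.M)

/-- **The `S″`-piece of the universal family is quasi-projective over `ℂ`**: for a fine Siegel moduli scheme `𝓜` over `ℚ`
whose universal total space `univ.A → 𝓜 → Spec ℚ` is quasi-projective (the (F-c″) input; [Lan13, Thm. 1.4.1.11] / MFK Thm. 7.9)
and an open `ℂ`-immersion `ι′ : S″ → 𝓜_ℂ` with `ℚ`-form `ι′ℚ`, the total space of `(𝓜.univ.baseChange ι′ℚ).A → S″ → Spec ℂ`
is quasi-projective over `ℂ`. [cite: MumfordFogartyKirwan1994, Ch. 7 §3 Theorem 7.9 (p. 139)] -/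
theorem isQuasiProjectiveOver_univ_piece (hι : ι'.left ≫ baseChangeHomFst (algebraMap ℚ ℂ) 𝓜.M = ι'ℚ.left)
    (hX : IsQuasiProjectiveOver (Over.mk (𝓜.univ.A.X.hom ≫ 𝓜.M.hom) : SchemeOver ℚ)) :
    IsQuasiProjectiveOver
      (Over.mk ((𝓜.univ.A.baseChange (S' := S''.left) ι'ℚ.left).X.hom ≫ S''.hom) : SchemeOver ℂ) :=
  isQuasiProjectiveOver_pullback_piece 𝓜.univ.A.X.hom ι'ℚ ι' hι hX

/-- **`hcov` for the `S″`-piece of the universal family** — the `hcov` binder of the (ii)-chain quotient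
`A′/K` (★ `AbelianSchemeOver.quotientBy A′ S″.hom K hcov …`) for `A′ := (𝓜.univ.baseChange ι′ℚ).A`, every finite `K`:
every point of `A′` lies in a `K`-stable affine open over `Spec ℂ`. [cite: SGA1, Exp. V, Prop. 1.8]
[cite: MumfordAV1970, §7 Remark p. 69] -/
theorem hcov_univ_piece (hι : ι'.left ≫ baseChangeHomFst (algebraMap ℚ ℂ) 𝓜.M = ι'ℚ.left)
    (hX : IsQuasiProjectiveOver (Over.mk (𝓜.univ.A.X.hom ≫ 𝓜.M.hom) : SchemeOver ℚ))
    (K : Subgroup (𝓜.univ.A.baseChange (S' := S''.left) ι'ℚ.left).Sections) [Finite K] :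
    ∀ x : (𝓜.univ.A.baseChange (S' := S''.left) ι'ℚ.left).left,
      ∃ O : ((𝓜.univ.A.baseChange (S' := S''.left) ι'ℚ.left).translationActionOver S''.hom K).StableAffineOpens,
        x ∈ O.1 :=
  hcov_baseChange_piece 𝓜.univ.A ι' ι'ℚ hι hX K

/-- The same in the `PolarizedAbelianSchemeWithLevel.baseChange` spelling of the (O-y) assembler
(`(P.baseChange g).A = P.A.baseChange g` is ★ `PolarizedAbelianSchemeWithLevel.baseChange_A`, definitional).
[cite: SGA1, Exp. V, Prop. 1.8] [cite: MumfordAV1970, §7 Remark p. 69] -/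
theorem hcov_univ_piece' (hι : ι'.left ≫ baseChangeHomFst (algebraMap ℚ ℂ) 𝓜.M = ι'ℚ.left)
    (hX : IsQuasiProjectiveOver (Over.mk (𝓜.univ.A.X.hom ≫ 𝓜.M.hom) : SchemeOver ℚ))
    (K : Subgroup (PolarizedAbelianSchemeWithLevel.baseChange (S' := S''.left) 𝓜.univ ι'ℚ.left).A.Sections) [Finite K] :
    ∀ x : (PolarizedAbelianSchemeWithLevel.baseChange (S' := S''.left) 𝓜.univ ι'ℚ.left).A.left,
      ∃ O : ((PolarizedAbelianSchemeWithLevel.baseChange (S' := S''.left) 𝓜.univ ι'ℚ.left).A.translationActionOver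
        S''.hom K).StableAffineOpens, x ∈ O.1 :=
  @hcov_univ_piece g N δ 𝓜 S'' ι' _ ι'ℚ hι hX K ‹Finite K›

end Univ

end Literature.AlgebraicGeometry.ModuliOfAbelianVarieties

end
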